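import Mathlib
import Summits.ResolutionOfSingularities.ResolutionOfSingularities.Theorems.IndSmoothValuativeSmoothingDevissageStepLemmas
import HarnessLib

/-!
# The field `F(a)` lies in the coarsening `O[1/a]` (crux `IndSmooth.ValuativeSmoothing`)

Crux `stmt-ResolutionOfSingularities-16087`, line `birth`, lead c1 dévissage programme
"discrete jumps", wave 2: stub E0 `adjoin_le_overring_of_maximalIdeal_eq`.

Let `O` be a valuation subring of a field `K ⊇ k` with principal maximal ideal `𝔪_O = aO`,
`a ≠ 0`, let `O' = O[1/a] = {z | aⁿ z ∈ O for some n}` be its coarsening, and let `F ⊆ O` be an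
intermediate field of `K/k`. Then the intermediate field `F(a) = F ⊔ k(a)` generated by `F`
and `a` is contained in `O'`. Indeed `a` is transcendental over `F`
(`DevissageStep.aeval_injective_of_maximalIdeal_eq`), so every element of `F(a)` is a quotient
`P(a) / Q(a)` with `P, Q ∈ F[X]` (`DevissageStep.exists_ringEquiv_residueField_bot`); if
`Q ≠ 0` then `Q(a) = aᵐ u` with `u` a unit of `O` (`DevissageStep.aeval_eq_pow_mul_of_ne_zero`),
whence `aᵐ · P(a) / Q(a) = P(a) u⁻¹ ∈ O`.

## Sources

* Elementary commutative algebra. [folklore]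

## Design notes

The `F`-algebra structure on `O` is built locally from the inclusion `F ⊆ O` (`hFO`), so that
the lemmas of `IndSmoothValuativeSmoothingDevissageStepLemmas` (phrased over `[Algebra F O]`)
apply; `IsScalarTower F O K` holds by `rfl`.
-/

-- single-problem summit: the doubled namespace component is forced
set_option linter.dupNamespace false

open Polynomial

namespace Summit.ResolutionOfSingularities.ResolutionOfSingularities.Theorems.ValuativeSmoothing

/-- Stub E0: the field generated by `F` and a generator `a` of the principal maximal ideal of a
valuation ring `O ⊇ F` lies in the coarsening `O' = O[1/a]`. -/
theorem adjoin_le_overring_of_maximalIdeal_eq (k K : Type) [Field k] [Field K] [Algebra k K]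
    (O O' : ValuationSubring K) (a : K) (ha : a ∈ O) (ha0 : a ≠ 0)
    (hmax : IsLocalRing.maximalIdeal O = Ideal.span {(⟨a, ha⟩ : O)})
    (hO' : ∀ x : K, x ∈ O' ↔ ∃ n : ℕ, a ^ n * x ∈ O)
    (F : IntermediateField k K) (hFO : ∀ x : K, x ∈ F → x ∈ O)
    (x : K) (hx : x ∈ F ⊔ IntermediateField.adjoin k {a}) : x ∈ O' := by
  -- the `F`-algebra structure on `O` induced by the inclusion `F ⊆ O`
  letI : Algebra F O := RingHom.toAlgebra
    { toFun := fun c => ⟨c, hFO c c.2⟩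
      map_one' := rfl
      map_mul' := fun _ _ => rfl
      map_zero' := rfl
      map_add' := fun _ _ => rfl }
  haveI : IsScalarTower F O K := IsScalarTower.of_algebraMap_eq fun _ => rfl
  set y : O := ⟨a, ha⟩
  have hy0 : y ≠ 0 := fun h => ha0 (congrArg Subtype.val h)
  have haeval : ∀ q : F[X], aeval a q = ((aeval y q : O) : K) := fun q =>
    Polynomial.aeval_algebraMap_apply K y q
  -- `a` is transcendental over `F`
  have hinj : Function.Injective (aeval a : F[X] →ₐ[F] K) := by
    intro p q h
    refine DevissageStep.aeval_injective_of_maximalIdeal_eq y hmax hy0 (Subtype.val_injective ?_)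
    change ((aeval y p : O) : K) = ((aeval y q : O) : K)
    rw [← haeval, ← haeval]
    exact h
  -- so `x = P(a) / Q(a)` for some `P, Q ∈ F[X]`
  obtain ⟨e, he⟩ := DevissageStep.exists_ringEquiv_residueField_bot F _ a hinj rfl
  obtain ⟨p, q, -, hpq⟩ := IsFractionRing.div_surjective (A := F[X]) (e.symm ⟨x, hx⟩)
  have hxpq : x = aeval a p / aeval a q := by
    have h := congrArg (fun z => ((e z : ↥(F ⊔ IntermediateField.adjoin k {a})) : K)) hpq
    simp only [map_div₀, RingEquiv.apply_symm_apply, IntermediateField.coe_div, he] at h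
    exact h.symm
  by_cases hq0 : q = 0
  · rw [hxpq, hq0, map_zero, div_zero]
    exact zero_mem O'
  -- `Q(a) = aᵐ u` with `u` a unit of `O`, and `aᵐ x = P(a) u⁻¹ ∈ O`
  obtain ⟨m, u, hu, hmu⟩ := DevissageStep.aeval_eq_pow_mul_of_ne_zero y hmax q hq0
  rw [hO']
  refine ⟨m, ?_⟩
  have hu' : (u : K)⁻¹ = ((↑(hu.unit⁻¹ : Oˣ) : O) : K) := by
    refine inv_eq_of_mul_eq_one_right ?_
    rw [← MulMemClass.coe_mul, IsUnit.mul_val_inv, OneMemClass.coe_one]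
  rw [hxpq, haeval q, hmu, MulMemClass.coe_mul, SubmonoidClass.coe_pow, ← mul_div_assoc,
    show ((y : O) : K) = a from rfl, mul_div_mul_left _ _ (pow_ne_zero m ha0), div_eq_mul_inv,
    hu', haeval p, ← MulMemClass.coe_mul]
  exact SetLike.coe_mem _

end Summit.ResolutionOfSingularities.ResolutionOfSingularities.Theorems.ValuativeSmoothing
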